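import Mathlib.Data.Nat.Log
import Mathlib.Algebra.Polynomial.Eval.Degree
import Mathlib.Tactic.Linarith
import Mathlib.Tactic.Positivity
import Mathlib.Tactic.Ring
import Literature.Computability.Complexity.AccFanIn
import Literature.Computability.Complexity.CircuitClassesProofs
import Literature.Computability.Complexity.CircuitLowerBounds
import HarnessLib

/-!
# Stub stub_symPlus_of_mem_ACC0 (line Sketch, crux CircuitNpAcc0)

Helper file for the crux `CircuitNpAcc0 = ¬ (NP ⊆ ACC⁰)` (item `stmt-PneNP-0037`, `--supports`; closes
nothing by itself). It proves the stub `stub_symPlus_of_mem_ACC0` of the line `Sketch` (Jacobi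
level-set road): **`ACC⁰ ⊆ SYM⁺` at the language level** — every `ACC⁰` language `L` has an exponent
`e` and a threshold `n₀` such that for every `n ≥ n₀` some `SYM⁺` term system with at most
`2 ^ (log₂ n + 2) ^ e` AND-terms, each of fan-in at most `(log₂ n + 2) ^ e`, computes the slice
`L.sliceFn n` (Yao 1990; Beigel–Tarui 1994, Thm. 1.1; Williams 2014, Lemma 4.1 — all already proved
in the tree PER CIRCUIT as `Williams2014_symPlus_of_acc_holds`; this file is the bookkeeping from
circuits to languages).

**Proof.** Unpack `L ∈ ACC0 = ⋃_{m ≥ 2} AC0Mod m`: a modulus `m ≥ 2`, a depth `d`, a size polynomial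
`p` and a circuit family `C` over `accBasis m` with `acDepth (C n) ≤ d`, `size (C n) ≤ p n`, deciding
`L`. At a length `n ≥ 1` normalise the fan-in of `C n` (`Circuit.exists_normFanIn`: same number of
gates, no larger depth, fan-in `≤ m (n + size)`, same function) and apply the per-circuit
representation theorem `Williams2014_symPlus_of_acc_holds` (exponent `e₀ = e₀(d, m)`) with the common
bound `s = m (n + p n)` on inputs, gates and fan-in: a `SYM⁺` system with the two bounds in
`log₂ s + 2`. Absorption into one exponent of `log₂ n + 2`: `s ≤ A · n ^ D` with `A = m (1 + p 1)`,
`D = deg p + 1` (`natPoly_eval_le_eval_one_mul_pow`), so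
`log₂ s + 2 ≤ log₂ A + D (log₂ n + 1) + 2 ≤ K (log₂ n + 2) ≤ (log₂ n + 2) ^ (K + 1)` for the constant
`K = log₂ A + D + 2` (because `log₂ n + 2 ≥ 2` and `K < 2 ^ K`), whence
`(log₂ s + 2) ^ e₀ ≤ (log₂ n + 2) ^ ((K + 1) e₀)`; take `e = (K + 1) e₀`, `n₀ = 1`. Finally
`S.eval x = (C n).eval x = [List.ofFn x ∈ L] = L.sliceFn n x` (`CircuitFamily.Decides.eval_eq`).

Design: the absorption lemmas (`symPlusACC0_*`) are stated for all `n` (no threshold) and for abstract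
constants `A`, `D`, `e₀`, so that the only place where `n ≥ 1` is used is the polynomial bound
`p n ≤ p 1 · n ^ deg p`.
-/

set_option linter.dupNamespace false -- `Summit.PneNP.PneNP.…`: summit = sub-problem (D-0017)

namespace Summit.PneNP.PneNP.Theorems.CircuitNpAcc0

open Finset Literature.Computability.Complexity

/-! ## §1 Arithmetic of the absorption: `poly(n)` inside `log₂` becomes one exponent of `log₂ n + 2` -/

/-- `log₂ (A · n ^ D) ≤ log₂ A + D (log₂ n + 1)`, from `A < 2 ^ (log₂ A + 1)` and
`n < 2 ^ (log₂ n + 1)`. [folklore] -/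
theorem symPlusACC0_log_mul_pow_le (A D n : ℕ) :
    Nat.log 2 (A * n ^ D) ≤ Nat.log 2 A + D * (Nat.log 2 n + 1) := by
  have hA : A < 2 ^ (Nat.log 2 A + 1) := Nat.lt_pow_succ_log_self Nat.one_lt_two A
  have hn : n ^ D ≤ 2 ^ (D * (Nat.log 2 n + 1)) := by
    rw [pow_mul']
    exact Nat.pow_le_pow_left (Nat.lt_pow_succ_log_self Nat.one_lt_two n).le D
  have hlt : A * n ^ D < 2 ^ (Nat.log 2 A + 1 + D * (Nat.log 2 n + 1)) := by
    rw [pow_add]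
    exact Nat.mul_lt_mul_of_lt_of_le hA hn (by positivity)
  have := Nat.log_lt_of_lt_pow' (by omega) hlt
  omega

/-- `K · k ≤ k ^ (K + 1)` for `k ≥ 2` (as `K < 2 ^ K ≤ k ^ K`). [folklore] -/
theorem symPlusACC0_mul_le_pow_succ (K k : ℕ) (hk : 2 ≤ k) : K * k ≤ k ^ (K + 1) := by
  rw [pow_succ]
  exact Nat.mul_le_mul_right k (Nat.lt_two_pow_self.le.trans (Nat.pow_le_pow_left hk K))

/-- `a + D (l + 1) + 2 ≤ (a + D + 2) (l + 2)` (expand the right-hand side). [folklore] -/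
theorem symPlusACC0_lin_le_mul (a D l : ℕ) : a + D * (l + 1) + 2 ≤ (a + D + 2) * (l + 2) := by
  have h1 : a ≤ a * (l + 2) := Nat.le_mul_of_pos_right a (by omega)
  have h2 : D * (l + 1) ≤ D * (l + 2) := Nat.mul_le_mul_left D (by omega)
  calc a + D * (l + 1) + 2 ≤ a * (l + 2) + D * (l + 2) + 2 * (l + 2) := by omega
    _ = (a + D + 2) * (l + 2) := by ring

/-- **Absorption.** For constants `A`, `D`, `e₀` there is ONE exponent `e` with
`(log₂ (A · n ^ D) + 2) ^ e₀ ≤ (log₂ n + 2) ^ e` for every `n` (namely `e = (log₂ A + D + 3) e₀`).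
[folklore] -/
theorem symPlusACC0_absorb (A D e₀ : ℕ) :
    ∃ e : ℕ, ∀ n : ℕ, (Nat.log 2 (A * n ^ D) + 2) ^ e₀ ≤ (Nat.log 2 n + 2) ^ e := by
  refine ⟨(Nat.log 2 A + D + 2 + 1) * e₀, fun n => ?_⟩
  rw [pow_mul]
  refine Nat.pow_le_pow_left ?_ e₀
  calc Nat.log 2 (A * n ^ D) + 2
      ≤ Nat.log 2 A + D * (Nat.log 2 n + 1) + 2 :=
        Nat.add_le_add_right (symPlusACC0_log_mul_pow_le A D n) 2
    _ ≤ (Nat.log 2 A + D + 2) * (Nat.log 2 n + 2) := symPlusACC0_lin_le_mul _ _ _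
    _ ≤ (Nat.log 2 n + 2) ^ (Nat.log 2 A + D + 2 + 1) :=
        symPlusACC0_mul_le_pow_succ _ _ (Nat.le_add_left 2 _)

/-- The common size/fan-in bound is polynomial: `m (n + p n) ≤ m (1 + p 1) · n ^ (deg p + 1)` for
`n ≥ 1` (`natPoly_eval_le_eval_one_mul_pow`: `p n ≤ p 1 · n ^ deg p`). [folklore] -/
theorem symPlusACC0_bound_le_mul_pow (m : ℕ) (p : Polynomial ℕ) {n : ℕ} (hn : 1 ≤ n) :
    m * (n + p.eval n) ≤ m * (1 + p.eval 1) * n ^ (p.natDegree + 1) := by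
  have h1 : n ≤ n ^ (p.natDegree + 1) := Nat.le_self_pow (Nat.succ_ne_zero _) n
  have h2 : p.eval n ≤ p.eval 1 * n ^ (p.natDegree + 1) :=
    (natPoly_eval_le_eval_one_mul_pow p hn).trans
      (Nat.mul_le_mul_left _ (Nat.pow_le_pow_right hn (Nat.le_succ _)))
  calc m * (n + p.eval n) ≤ m * (n ^ (p.natDegree + 1) + p.eval 1 * n ^ (p.natDegree + 1)) :=
        Nat.mul_le_mul_left m (Nat.add_le_add h1 h2)
    _ = m * (1 + p.eval 1) * n ^ (p.natDegree + 1) := by ring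

/-! ## §2 The stub: `ACC⁰ ⊆ SYM⁺` at the language level -/

/-- **Stub S1 of the line `Sketch` (`stub_symPlus_of_mem_ACC0`): `ACC⁰ ⊆ SYM⁺` at the language
level.** Every `ACC⁰` language has, at all large lengths `n`, a `SYM⁺` term system with at most
`2 ^ (log₂ n + 2) ^ e` terms of fan-in at most `(log₂ n + 2) ^ e` computing its `n`-th slice
(Yao 1990; Beigel–Tarui 1994, Thm. 1.1; Williams 2014, Lemma 4.1). Bookkeeping over the tree's proved
theorems `Williams2014_symPlus_of_acc_holds` (per circuit, bounds in a common size/fan-in bound `s`)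
and `Circuit.exists_normFanIn` (fan-in `≤ m (n + size)`), with `s = m (n + p n) = poly(n)` absorbed
into one exponent by `symPlusACC0_absorb`; threshold `n₀ = 1`. -/
theorem stub_symPlus_of_mem_ACC0 : ∀ L ∈ ACC0, ∃ e n₀ : ℕ, ∀ n ≥ n₀, ∃ S : SymPlus n,
    S.size ≤ 2 ^ (Nat.log 2 n + 2) ^ e ∧ S.maxFanIn ≤ (Nat.log 2 n + 2) ^ e ∧
      ∀ x, S.eval x = L.sliceFn n x := by
  intro L hL
  simp only [ACC0, Set.mem_iUnion] at hL
  obtain ⟨m, hm, d, p, C, hC, hdec⟩ := hL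
  have hm0 : 0 < m := lt_of_lt_of_le Nat.zero_lt_two hm
  obtain ⟨e₀, he₀⟩ := Williams2014_symPlus_of_acc_holds d m hm
  obtain ⟨e, he⟩ := symPlusACC0_absorb (m * (1 + p.eval 1)) (p.natDegree + 1) e₀
  refine ⟨e, 1, fun n hn => ?_⟩
  obtain ⟨hover, hdepth, hsize⟩ := hC n
  obtain ⟨C', hover', hsize', hdepth', hfan', heval'⟩ := Circuit.exists_normFanIn hm0 (C n) hover
  -- the common bound `s = m (n + p n)` on inputs, gates and fan-in of the normalised circuit
  have hns : n ≤ m * (n + p.eval n) :=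
    (Nat.le_add_right n _).trans (Nat.le_mul_of_pos_left _ hm0)
  have hCs : C'.size ≤ m * (n + p.eval n) := by
    rw [hsize']
    exact (hsize.trans (Nat.le_add_left _ n)).trans (Nat.le_mul_of_pos_left _ hm0)
  have hCf : C'.maxFanIn ≤ m * (n + p.eval n) :=
    hfan'.trans (Nat.mul_le_mul_left m (Nat.add_le_add_left hsize n))
  obtain ⟨S, hSsize, hSfan, hSeval⟩ :=
    he₀ n (m * (n + p.eval n)) C' hover' (hdepth'.trans hdepth) hns hCs hCf
  -- absorption of `log₂ s` into one exponent of `log₂ n + 2`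
  have hlog : (Nat.log 2 (m * (n + p.eval n)) + 2) ^ e₀ ≤ (Nat.log 2 n + 2) ^ e := by
    refine le_trans (Nat.pow_le_pow_left ?_ e₀) (he n)
    exact Nat.add_le_add_right (Nat.log_mono_right (symPlusACC0_bound_le_mul_pow m p hn)) 2
  refine ⟨S, hSsize.trans (Nat.pow_le_pow_right Nat.zero_lt_two hlog), hSfan.trans hlog,
    fun x => ?_⟩
  rw [hSeval, heval']
  exact hdec.eval_eq x

end Summit.PneNP.PneNP.Theorems.CircuitNpAcc0
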